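import Literature.MathematicalPhysics.QuantumFieldTheory.Balaban1983to89.B8Eq158AtLettersY

/-!
# `Balaban1983to89.B8Ineq159AtLettersY` — T. Bałaban, *Spaces of regular gauge field configurations on a lattice and gauge fixing conditions*,
# Commun. Math. Phys. **99** (1985) 75–102 [Balaban1985RegularSpaces], (1.59)–(1.60) p. 86 AT A GENERAL BACKGROUND `U`, AT THE CELL's COVARIANT
# LETTERS OF RECORD (def-Y, `Node00.OpsYDeltaA` ∕ `OpsYOfLetters`): the three genuine members of (1.59) — `|A|₍₋₁₎`, `|∇_U A|₍₋₂₎`, `|Δ_U A|₍₋₃₎ ≦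
# 2B₀(|D*_U D_U A|₍₋₃₎ + |Q*(U)aQ(U)A|₍₋₃₎)` — for a Landau-gauge field, from [4] (3.47)-shape operator bounds of `G(U) = Δ_a(U)⁻¹` in the weighted
# norms (3.41) and a (3.69)-shape bound on the curvature insertion, by print's own bootstrap

statement-level skeleton of published theorems with citation tags; proofs where landed; nothing here is a claim about the Yang–Mills mass gap

PDF held: `paper:balaban1985-cmp99-regular-spaces-gauge-fixing` (journal page = PDF page + 74); p. 86 [PDF 12] read AS AN IMAGE this session (render
`run/shared/lean/pub/pub-balaban/b2b-balaban-ref1/pages/1985-cmp99-regular-spaces-gauge-fixing/1985-cmp99-regular-spaces-gauge-fixing-p012-x2.png`);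
[4] = T. Bałaban, *Propagators for lattice gauge theories in a background field*, Commun. Math. Phys. **99** (1985) 389–434 [Balaban1985BackgroundPropagators]:
(3.41) p. 397, (3.47) p. 398, Thm 3.3 p. 399, (3.69) p. 404 — through the tree modules `Node00.OpsYOfLetters` (`wNormBY`, `cdB`, `lapB`) and
`B9SupplySockB9P3ZdLetters` (verbatim quotations of (3.47), (3.69)).

CITATION HEADER (lean-in-tree rule).  Cell `lit-balaban`, seat `lit-balaban-r05` (gen 86; [B8] block owner), sub-row G-B8-T2S ∕ the displayed (B)-lines of the
M5.9 knit (lead g32 RULING #8 (2): «B-LINE 2 per your memo after B-LINE 1 lands»); design memo `lit-balaban-r05/BLINE-DESIGN-r05.md` v1.2 §3, file B-LINE 2 =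
the DEF-Y-SIDE half of t2s-1 g6's three-line target `B8Thm2TorusB9LineReduced.B9P3ThreeAt` (A16): the three weighted-sup bounds PRODUCED AT DEF-Y's CARRIER, the
carrier transport to the knit's `msup ∕ bondNorm ∕ Jcur ∕ covDerivFwd ∕ covLap ∕ linCovIter` being the junction lineage's (B-LINE 3).  REUSED BY NAME: B-LINE 1
`B8Eq158AtLettersY.eq158_atLettersY` ∕ `hessY_apply_eq_dStarD_add_curv` (p637444), def-Y's `wNormBY ∕ cdB ∕ lapB ∕ GAY ∕ deltaAY ∕ RY ∕ …`, r05's `B8ScaledSupNorm`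
(`msup`, `weight`, `Bdd`, `msup_le`, `weight_mul_norm_le_msup`), r06-lineage `B9GeoNormsKLevelV1.blkV1_level_le`.

WHAT IS PRINTED (verbatim, p. 86 [PDF 12]).  *"Theorem 3.3 of [4] implies the bounds: |A|₍₋₁₎, |∇^η_{U₀}A|₍₋₂₎, |D^{η*}_{U₀}D^η_{U₀}A|₍₋₃₎, |Δ^η_{U₀}A|₍₋₃₎ ≦
B₀(|J|₍₋₃₎ + |B₁|) ≦ B₀(2α₀ + 36dα₂|∇^η_{U₀}A|₍₋₂₎ + 50dα₂³ + 10dα₀α₂ + 2dLα₁ + C₂α₂²). (1.59)  Let us take this bound for |∇^η_{U₀}A|₍₋₂₎ on the left-hand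
side, and let us assume that B₀36dα₂ ≦ 1/2. This gives us a bound for |∇^η_{U₀}A|₍₋₂₎, equal to the right-hand side above without this term and multiplied
by 2."*; p. 86, after (1.55): *"|A|₍α₎ = sup_j sup_{Ω_j}(Lʲη)^{−α}|A|"*; Prop. 3 p. 87: *"where B₀, B₀(β₀) are the corresponding norms of the operators G(U₀),
H(U₀), and depend on d and L only"*.  [4] (3.47) p. 398: *"the global inequalities |G′(U)λ|₍₂₊γ₎, |∇_UG′(U)λ|₍₁₊γ₎, |G′(U)∇*_Uλ|₍₁₊γ₎, |Δ_UG′(U)λ|₍γ₎ ≦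
B₀|λ|₍γ₎ (3.47) for γ in a fixed compact subset of real numbers, e.g. for γ ∈ [−4, 4]"*; Thm 3.3 p. 399: *"the same statements hold for the operators G(U) …
with G′(U) replaced by G(U) and λ replaced by a function J defined at bonds"*; (3.69) p. 404: *"|(Δ′(U′U)A′)(b)| ≦ O(1)(Mα₀ + α₁)(Lʲη)⁻²|A′|, b ∈ Ω_j"*.

THE MATHEMATICS (kernel-checked).  `|·|₍α₎ := wNormBY i α` (def-Y's reading of p. 86 ∕ (3.41) = r05's `msup` at `L = ℓ+1`, `η = |c_f|⁻¹`, levels of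
`blkV1`).  §1 makes the weighted norm usable on `𝔸`-valued bond fields: on the finite carrier every family is bounded (`bdd_wNormBY`), each weighted
member lies below the norm (`weight_mul_norm_le_wNormBY`), the norm is non-negative, subadditive (`wNormBY_add_le`, `wNormBY_add_add_le`) — the
triangle inequality print uses silently in «|J|₍₋₃₎ + |B₁|».  §2 is PRINT's BOOTSTRAP at the letters: for `A` in the Landau gauge of `U` and `Δ_a(U)` a unit,
B-LINE 1 gives `A = G(U)F`, `F = D*_U D_U A + Δ′(U)A + Q*(U)aQ(U)A` (`eq158_atLettersY` + `hessY_apply_eq_dStarD_add_curv`); the displayed (3.47)_{γ=−3}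
bounds of `G(U)` (`hG0 : |G(U)F|₍₋₁₎ ≦ B₀|F|₍₋₃₎`, `hG1 : |∇_{U,ν}G(U)F|₍₋₂₎ ≦ B₀|F|₍₋₃₎`, `hG3 : |Δ_U G(U)F|₍₋₃₎ ≦ B₀|F|₍₋₃₎`) and the displayed
(3.69)-shape bound `hcurv : |Δ′(U)A|₍₋₃₎ ≦ κ|A|₍₋₁₎` give `|A|₍₋₁₎ ≦ B₀(|J|₍₋₃₎ + κ|A|₍₋₁₎ + |Q*aQA|₍₋₃₎)`, so for `2B₀κ ≦ 1` — print's «B₀36dα₂ ≦ 1/2 …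
multiplied by 2» — ★ `wNormBY_neg_one_le` : `|A|₍₋₁₎ ≦ 2B₀(|D*_U D_U A|₍₋₃₎ + |Q*(U)aQ(U)A|₍₋₃₎)`, and then ★ `wNormBY_cdB_le` (every direction `ν`), ★
`wNormBY_lapB_le`, ★★ `ineq159_three_atLettersY` (the conjunction) with the SAME constant `2B₀`.  The averaging member is kept as the norm
`|Q*(U)aQ(U)A|₍₋₃₎` (print: `|B₁|` up to «q = sup_j‖Q_j*‖», the junction's `AvgBound` step); the third printed member `|D*DA|₍₋₃₎` is `|J|₍₋₃₎` itself.

HONEST SCOPE.  The analytic content of (1.59) — [4] Theorem 3.3 for `G(U)` at a general regular `U` and (3.69) — is DISPLAYED (`hG0 ∕ hG1 ∕ hG3 ∕ hcurv`, the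
shapes M5.7's endpoints `B9Thm310GOfLocalInverseCubes.…''` + r06's (3.47) machinery and the curvature files (pub-ymgap `B9Eq369…`, `CurvSmall`) deliver), as
are `IsUnit (deltaAY …)` (M5.3 ∕ p38 F4) and the Landau condition in def-Y's projection form; NOTHING of [4] is proved here; constants: print's `B₀` READ AS
`2B₀` after the bootstrap (as dag-n06-b's `B8FromB9.b8_159_repaired` and pub-ymgap's `sockB9P3_at` do at the `ℤᵈ` carrier); the Hölder member of (1.59) is
not treated (A16: `β₀ = 0` on the consumer's path); the transport to the knit's carrier is NOT here (B-LINE 3).  General coefficient algebra `𝔸` (normed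
ℂ-algebra, complete), general `parS ∕ parB ∕ Gp`.  Count-neutral; `B9P3PerAt` ∕ `B9P3ThreeAt` ∕ `stub_PV3A` NOT discharged; nothing continuum ∕ ℝ⁴ ∕ OS ∕
mass-gap ∕ Clay — the Yang–Mills mass gap is NOT proved by any of this (Track A conditional rung).  No `sorry`, no `def`, no `… : Prop` fact, no `instance`,
no `notation`.  NEW file; nothing landed is modified.  Seat `lit-balaban-r05` gen 86, 2026-08-28.
-/

noncomputable section

namespace Literature.MathematicalPhysics.QuantumFieldTheory.Balaban1983to89.B8Ineq159AtLettersY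

open Node00
open B6KLevelCensusIndexV1 (KIdx)
open B6GlobalChartV1 (PV blkV1)
open B8ScaledSupNorm (msup weight Bdd msup_le msup_nonneg weight_mul_norm_le_msup weight_nonneg)
open B9GeoNormsKLevelV1 (blkV1_level_le)
open B8Eq158AtLettersY (eq158_atLettersY hessY_apply_eq_dStarD_add_curv)

variable {d ℓ : ℕ} {hd : 1 ≤ d + 1} {hL : Odd (ℓ + 1) ∧ 1 < ℓ + 1} {b₀ b₁ : ℝ}
variable {𝔸 : Type} [NormedRing 𝔸] [NormedAlgebra ℂ 𝔸] [CompleteSpace 𝔸]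
variable (i : KIdx d ℓ hd hL b₀ b₁)

/-! ## §1 The weighted norm `|Ψ|₍α₎ = wNormBY i α Ψ` on `𝔸`-valued bond fields: boundedness, members below the norm, triangle inequality -/

section Norm

omit [NormedAlgebra ℂ 𝔸] [CompleteSpace 𝔸] in
/-- On the finite bond carrier every weighted family is bounded (the side condition of r05's real `msup`).
[cite: Balaban1985RegularSpaces, p.86 (definition after (1.55)); Balaban1985BackgroundPropagators, (3.41) p.397] -/
theorem bdd_wNormBY (α : ℝ) (Ψ : FBondY i → 𝔸) :
    Bdd (ℓ + 1) i.k |i.cf|⁻¹ α (fun j (x : FBondY i) => (blkV1 i.hN i.D x).1.1 = j) Ψ := by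
  classical
  refine ⟨∑ x : FBondY i, weight (ℓ + 1) |i.cf|⁻¹ α (blkV1 i.hN i.D x).1.1 * ‖Ψ x‖, fun j _ x hx => ?_⟩
  have hx' : (blkV1 i.hN i.D x).1.1 = j := hx
  rw [← hx']
  exact Finset.single_le_sum (f := fun y : FBondY i => weight (ℓ + 1) |i.cf|⁻¹ α (blkV1 i.hN i.D y).1.1 * ‖Ψ y‖)
    (fun y _ => mul_nonneg (weight_nonneg _ (inv_nonneg.2 (abs_nonneg _)) _ _) (norm_nonneg _)) (Finset.mem_univ x)

omit [NormedAlgebra ℂ 𝔸] [CompleteSpace 𝔸] in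
/-- Each weighted member lies below the norm: `(L^{j(b)}η)^{−α}‖Ψ(b)‖ ≤ |Ψ|₍α₎`. [cite: Balaban1985RegularSpaces, p.86 (definition after (1.55))] -/
theorem weight_mul_norm_le_wNormBY (α : ℝ) (Ψ : FBondY i → 𝔸) (x : FBondY i) :
    weight (ℓ + 1) |i.cf|⁻¹ α (blkV1 i.hN i.D x).1.1 * ‖Ψ x‖ ≤ wNormBY i α Ψ :=
  weight_mul_norm_le_msup (bdd_wNormBY i α Ψ) (blkV1_level_le i x) rfl

omit [NormedAlgebra ℂ 𝔸] [CompleteSpace 𝔸] in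
/-- `0 ≤ |Ψ|₍α₎`. [cite: Balaban1985RegularSpaces, p.86 (definition after (1.55))] -/
theorem wNormBY_nonneg (α : ℝ) (Ψ : FBondY i → 𝔸) : 0 ≤ wNormBY i α Ψ :=
  msup_nonneg _ _ (inv_nonneg.2 (abs_nonneg _)) _ _ _

omit [NormedAlgebra ℂ 𝔸] [CompleteSpace 𝔸] in
/-- A pointwise weighted bound by `c ≥ 0` bounds the norm. [cite: Balaban1985RegularSpaces, p.86 (definition after (1.55))] -/
theorem wNormBY_le_of_weight_mul_norm_le {α c : ℝ} (hc : 0 ≤ c) {Ψ : FBondY i → 𝔸}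
    (h : ∀ x : FBondY i, weight (ℓ + 1) |i.cf|⁻¹ α (blkV1 i.hN i.D x).1.1 * ‖Ψ x‖ ≤ c) : wNormBY i α Ψ ≤ c := by
  unfold wNormBY
  refine msup_le hc fun j _ x hx => ?_
  have hx' : (blkV1 i.hN i.D x).1.1 = j := hx
  rw [← hx']
  exact h x

omit [NormedAlgebra ℂ 𝔸] [CompleteSpace 𝔸] in
/-- **TRIANGLE INEQUALITY** of the weighted norm: `|Ψ + Φ|₍α₎ ≤ |Ψ|₍α₎ + |Φ|₍α₎` (used silently in print's «|J|₍₋₃₎ + |B₁|»).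
[cite: Balaban1985RegularSpaces, (1.59) p.86] -/
theorem wNormBY_add_le (α : ℝ) (Ψ Φ : FBondY i → 𝔸) : wNormBY i α (Ψ + Φ) ≤ wNormBY i α Ψ + wNormBY i α Φ := by
  refine wNormBY_le_of_weight_mul_norm_le i (add_nonneg (wNormBY_nonneg i α Ψ) (wNormBY_nonneg i α Φ)) fun x => ?_
  have hw : 0 ≤ weight (ℓ + 1) |i.cf|⁻¹ α (blkV1 i.hN i.D x).1.1 := weight_nonneg _ (inv_nonneg.2 (abs_nonneg _)) _ _
  calc weight (ℓ + 1) |i.cf|⁻¹ α (blkV1 i.hN i.D x).1.1 * ‖(Ψ + Φ) x‖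
      ≤ weight (ℓ + 1) |i.cf|⁻¹ α (blkV1 i.hN i.D x).1.1 * (‖Ψ x‖ + ‖Φ x‖) :=
        mul_le_mul_of_nonneg_left (norm_add_le _ _) hw
    _ = weight (ℓ + 1) |i.cf|⁻¹ α (blkV1 i.hN i.D x).1.1 * ‖Ψ x‖ + weight (ℓ + 1) |i.cf|⁻¹ α (blkV1 i.hN i.D x).1.1 * ‖Φ x‖ := by ring
    _ ≤ wNormBY i α Ψ + wNormBY i α Φ := add_le_add (weight_mul_norm_le_wNormBY i α Ψ x) (weight_mul_norm_le_wNormBY i α Φ x)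

omit [NormedAlgebra ℂ 𝔸] [CompleteSpace 𝔸] in
/-- Three terms: `|Ψ + Φ + Χ|₍α₎ ≤ |Ψ|₍α₎ + |Φ|₍α₎ + |Χ|₍α₎`. [cite: Balaban1985RegularSpaces, (1.59) p.86] -/
theorem wNormBY_add_add_le (α : ℝ) (Ψ Φ Χ : FBondY i → 𝔸) :
    wNormBY i α (Ψ + Φ + Χ) ≤ wNormBY i α Ψ + wNormBY i α Φ + wNormBY i α Χ :=
  (wNormBY_add_le i α (Ψ + Φ) Χ).trans (by linarith [wNormBY_add_le i α Ψ Φ])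

end Norm

/-! ## §2 ★ (1.59)–(1.60) at the letters: the bootstrap from the (3.47)-shape bounds of `G(U)` and the (3.69)-shape curvature bound -/

section Ineq159

variable (parS : SiteParY 𝔸 i) (parB : BondParY 𝔸 i) (Gp : SiteOpY 𝔸 i) (U : CfgY 𝔸 i)

/-- The (1.58) source of a Landau-gauge field with the located curvature insertion: `A = G(U)F`,
`F = D*_U D_U A + Δ′(U)A + Q*(U)aQ(U)A` (B-LINE 1). [cite: Balaban1985RegularSpaces, (1.58) p.86; Balaban1985BackgroundPropagators, (3.10) p.392, (3.26)–(3.27) p.395] -/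
theorem eq158_source (hU : IsUnit (deltaAY i parS parB Gp U)) {A : FBondY i → 𝔸} (hLan : RY i parS Gp U (divY i U A) = 0) :
    A = GAY i parS parB Gp U
      (coCurlY i U (curlY i U A) + (coCurlY i U (jordanY i U (curlY i U A) - curlY i U A) + curv2Y i U A) +
        QsY i parB U (aY i (QY i parB U A))) := by
  rw [← hessY_apply_eq_dStarD_add_curv i U A]
  exact eq158_atLettersY i parS parB Gp U hU hLan

variable {B₀ κ : ℝ}

/-- the weighted norm of the (1.58) source: `|F|₍₋₃₎ ≤ |J|₍₋₃₎ + κ|A|₍₋₁₎ + |Q*aQA|₍₋₃₎` (triangle inequality + the curvature bound).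
[cite: Balaban1985RegularSpaces, (1.59) p.86; Balaban1985BackgroundPropagators, (3.69) p.404] -/
theorem wNormBY_source_le
    (hcurv : ∀ A : FBondY i → 𝔸, wNormBY i (-3) (coCurlY i U (jordanY i U (curlY i U A) - curlY i U A) + curv2Y i U A) ≤
      κ * wNormBY i (-1) A)
    (A : FBondY i → 𝔸) :
    wNormBY i (-3) (coCurlY i U (curlY i U A) + (coCurlY i U (jordanY i U (curlY i U A) - curlY i U A) + curv2Y i U A) +
        QsY i parB U (aY i (QY i parB U A))) ≤
      wNormBY i (-3) (coCurlY i U (curlY i U A)) + κ * wNormBY i (-1) A + wNormBY i (-3) (QsY i parB U (aY i (QY i parB U A))) := by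
  have h := wNormBY_add_add_le i (-3) (coCurlY i U (curlY i U A))
    (coCurlY i U (jordanY i U (curlY i U A) - curlY i U A) + curv2Y i U A) (QsY i parB U (aY i (QY i parB U A)))
  linarith [hcurv A]

/-- ★ **(1.59) FIRST MEMBER AFTER THE BOOTSTRAP (1.60)**: for `A` in the Landau gauge of `U`, `Δ_a(U)` a unit, the (3.47)_{γ=−3} bound `|G(U)F|₍₋₁₎ ≤ B₀|F|₍₋₃₎`
and the (3.69)-shape bound `|Δ′(U)A|₍₋₃₎ ≤ κ|A|₍₋₁₎` with `2B₀κ ≤ 1`:  `|A|₍₋₁₎ ≤ 2B₀(|D*_U D_U A|₍₋₃₎ + |Q*(U)aQ(U)A|₍₋₃₎)`.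
[cite: Balaban1985RegularSpaces, (1.59)–(1.60) p.86, Prop. 3 p.87; Balaban1985BackgroundPropagators, Thm 3.3 p.399, (3.47) p.398, (3.69) p.404] -/
theorem wNormBY_neg_one_le (hB₀ : 0 ≤ B₀) (hθ : 2 * B₀ * κ ≤ 1) (hU : IsUnit (deltaAY i parS parB Gp U))
    (hG0 : ∀ F : FBondY i → 𝔸, wNormBY i (-1) (GAY i parS parB Gp U F) ≤ B₀ * wNormBY i (-3) F)
    (hcurv : ∀ A : FBondY i → 𝔸, wNormBY i (-3) (coCurlY i U (jordanY i U (curlY i U A) - curlY i U A) + curv2Y i U A) ≤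
      κ * wNormBY i (-1) A)
    {A : FBondY i → 𝔸} (hLan : RY i parS Gp U (divY i U A) = 0) :
    wNormBY i (-1) A ≤
      2 * B₀ * (wNormBY i (-3) (coCurlY i U (curlY i U A)) + wNormBY i (-3) (QsY i parB U (aY i (QY i parB U A)))) := by
  set x := wNormBY i (-1) A with hx
  set S := wNormBY i (-3) (coCurlY i U (curlY i U A)) + wNormBY i (-3) (QsY i parB U (aY i (QY i parB U A))) with hS
  have hx0 : 0 ≤ x := wNormBY_nonneg i _ _
  have hS0 : 0 ≤ S := add_nonneg (wNormBY_nonneg i _ _) (wNormBY_nonneg i _ _)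
  have hA := eq158_source i parS parB Gp U hU hLan
  have h1 : x ≤ B₀ * (S + κ * x) := by
    have h := hG0 (coCurlY i U (curlY i U A) + (coCurlY i U (jordanY i U (curlY i U A) - curlY i U A) + curv2Y i U A) +
      QsY i parB U (aY i (QY i parB U A)))
    rw [← hA] at h
    have h2 := wNormBY_source_le i parB U hcurv A
    calc x ≤ B₀ * wNormBY i (-3) (coCurlY i U (curlY i U A) +
          (coCurlY i U (jordanY i U (curlY i U A) - curlY i U A) + curv2Y i U A) + QsY i parB U (aY i (QY i parB U A))) := h
      _ ≤ B₀ * (S + κ * x) := by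
          refine mul_le_mul_of_nonneg_left ?_ hB₀
          linarith
  have h3 : B₀ * κ * x ≤ x / 2 := by
    have : B₀ * κ ≤ 1 / 2 := by linarith
    calc B₀ * κ * x ≤ 1 / 2 * x := mul_le_mul_of_nonneg_right this hx0
      _ = x / 2 := by ring
  nlinarith

/-- ★ **(1.59) SECOND MEMBER** (every direction `ν`): under the same hypotheses plus `|∇_{U,ν}G(U)F|₍₋₂₎ ≤ B₀|F|₍₋₃₎`:
`|∇_{U,ν}A|₍₋₂₎ ≤ 2B₀(|D*_U D_U A|₍₋₃₎ + |Q*(U)aQ(U)A|₍₋₃₎)`. [cite: Balaban1985RegularSpaces, (1.59)–(1.60) p.86; Balaban1985BackgroundPropagators, (3.47) p.398, Thm 3.3 p.399] -/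
theorem wNormBY_cdB_le (hB₀ : 0 ≤ B₀) (hκ : 0 ≤ κ) (hθ : 2 * B₀ * κ ≤ 1) (hU : IsUnit (deltaAY i parS parB Gp U))
    (hG0 : ∀ F : FBondY i → 𝔸, wNormBY i (-1) (GAY i parS parB Gp U F) ≤ B₀ * wNormBY i (-3) F)
    (hG1 : ∀ (F : FBondY i → 𝔸) (ν : Fin (d + 1)), wNormBY i (-2) (cdB i U ν (GAY i parS parB Gp U F)) ≤ B₀ * wNormBY i (-3) F)
    (hcurv : ∀ A : FBondY i → 𝔸, wNormBY i (-3) (coCurlY i U (jordanY i U (curlY i U A) - curlY i U A) + curv2Y i U A) ≤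
      κ * wNormBY i (-1) A)
    {A : FBondY i → 𝔸} (hLan : RY i parS Gp U (divY i U A) = 0) (ν : Fin (d + 1)) :
    wNormBY i (-2) (cdB i U ν A) ≤
      2 * B₀ * (wNormBY i (-3) (coCurlY i U (curlY i U A)) + wNormBY i (-3) (QsY i parB U (aY i (QY i parB U A)))) := by
  set x := wNormBY i (-1) A with hx
  set S := wNormBY i (-3) (coCurlY i U (curlY i U A)) + wNormBY i (-3) (QsY i parB U (aY i (QY i parB U A))) with hS
  have hS0 : 0 ≤ S := add_nonneg (wNormBY_nonneg i _ _) (wNormBY_nonneg i _ _)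
  have hxle : x ≤ 2 * B₀ * S := wNormBY_neg_one_le i parS parB Gp U hB₀ hθ hU hG0 hcurv hLan
  have hA := eq158_source i parS parB Gp U hU hLan
  have h := hG1 (coCurlY i U (curlY i U A) + (coCurlY i U (jordanY i U (curlY i U A) - curlY i U A) + curv2Y i U A) +
    QsY i parB U (aY i (QY i parB U A))) ν
  rw [← hA] at h
  have h2 := wNormBY_source_le i parB U hcurv A
  have h4 : wNormBY i (-2) (cdB i U ν A) ≤ B₀ * (S + κ * x) := by
    refine h.trans (mul_le_mul_of_nonneg_left ?_ hB₀)
    linarith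
  have h5 : B₀ * (S + κ * x) ≤ 2 * B₀ * S := by
    have hk : κ * x ≤ κ * (2 * B₀ * S) := mul_le_mul_of_nonneg_left hxle hκ
    have : B₀ * (κ * (2 * B₀ * S)) = (2 * B₀ * κ) * (B₀ * S) := by ring
    nlinarith [mul_nonneg hB₀ hS0]
  exact h4.trans h5

/-- ★ **(1.59) FOURTH MEMBER**: under the same hypotheses plus `|Δ_U G(U)F|₍₋₃₎ ≤ B₀|F|₍₋₃₎`:
`|Δ_U A|₍₋₃₎ ≤ 2B₀(|D*_U D_U A|₍₋₃₎ + |Q*(U)aQ(U)A|₍₋₃₎)`. [cite: Balaban1985RegularSpaces, (1.59)–(1.60) p.86; Balaban1985BackgroundPropagators, (3.47) p.398, Thm 3.3 p.399] -/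
theorem wNormBY_lapB_le (hB₀ : 0 ≤ B₀) (hκ : 0 ≤ κ) (hθ : 2 * B₀ * κ ≤ 1) (hU : IsUnit (deltaAY i parS parB Gp U))
    (hG0 : ∀ F : FBondY i → 𝔸, wNormBY i (-1) (GAY i parS parB Gp U F) ≤ B₀ * wNormBY i (-3) F)
    (hG3 : ∀ F : FBondY i → 𝔸, wNormBY i (-3) (lapB i U (GAY i parS parB Gp U F)) ≤ B₀ * wNormBY i (-3) F)
    (hcurv : ∀ A : FBondY i → 𝔸, wNormBY i (-3) (coCurlY i U (jordanY i U (curlY i U A) - curlY i U A) + curv2Y i U A) ≤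
      κ * wNormBY i (-1) A)
    {A : FBondY i → 𝔸} (hLan : RY i parS Gp U (divY i U A) = 0) :
    wNormBY i (-3) (lapB i U A) ≤
      2 * B₀ * (wNormBY i (-3) (coCurlY i U (curlY i U A)) + wNormBY i (-3) (QsY i parB U (aY i (QY i parB U A)))) := by
  set x := wNormBY i (-1) A with hx
  set S := wNormBY i (-3) (coCurlY i U (curlY i U A)) + wNormBY i (-3) (QsY i parB U (aY i (QY i parB U A))) with hS
  have hS0 : 0 ≤ S := add_nonneg (wNormBY_nonneg i _ _) (wNormBY_nonneg i _ _)
  have hxle : x ≤ 2 * B₀ * S := wNormBY_neg_one_le i parS parB Gp U hB₀ hθ hU hG0 hcurv hLan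
  have hA := eq158_source i parS parB Gp U hU hLan
  have h := hG3 (coCurlY i U (curlY i U A) + (coCurlY i U (jordanY i U (curlY i U A) - curlY i U A) + curv2Y i U A) +
    QsY i parB U (aY i (QY i parB U A)))
  rw [← hA] at h
  have h2 := wNormBY_source_le i parB U hcurv A
  have h4 : wNormBY i (-3) (lapB i U A) ≤ B₀ * (S + κ * x) := by
    refine h.trans (mul_le_mul_of_nonneg_left ?_ hB₀)
    linarith
  have h5 : B₀ * (S + κ * x) ≤ 2 * B₀ * S := by
    have hk : κ * x ≤ κ * (2 * B₀ * S) := mul_le_mul_of_nonneg_left hxle hκ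
    have : B₀ * (κ * (2 * B₀ * S)) = (2 * B₀ * κ) * (B₀ * S) := by ring
    nlinarith [mul_nonneg hB₀ hS0]
  exact h4.trans h5

/-- ★★ **(1.59), THE THREE GENUINE MEMBERS TOGETHER, AT THE LETTERS OF RECORD** — t2s-1's three-line target `B9P3ThreeAt` read at def-Y's carrier:
for `A` in the Landau gauge of `U`, `Δ_a(U)` a unit, the three (3.47)_{γ=−3} operator bounds of `G(U)` and the (3.69)-shape curvature bound with `2B₀κ ≤ 1`,
`|A|₍₋₁₎ ≤ 2B₀S`, `∀ ν, |∇_{U,ν}A|₍₋₂₎ ≤ 2B₀S`, `|Δ_U A|₍₋₃₎ ≤ 2B₀S` with `S = |D*_U D_U A|₍₋₃₎ + |Q*(U)aQ(U)A|₍₋₃₎` (print's `|J|₍₋₃₎ + |B₁|` up to the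
junction's reading of the averaging member). [cite: Balaban1985RegularSpaces, (1.59)–(1.60) p.86, Prop. 3 p.87; Balaban1985BackgroundPropagators, Thm 3.3 p.399, (3.47) p.398, (3.69) p.404] -/
theorem ineq159_three_atLettersY (hB₀ : 0 ≤ B₀) (hκ : 0 ≤ κ) (hθ : 2 * B₀ * κ ≤ 1) (hU : IsUnit (deltaAY i parS parB Gp U))
    (hG0 : ∀ F : FBondY i → 𝔸, wNormBY i (-1) (GAY i parS parB Gp U F) ≤ B₀ * wNormBY i (-3) F)
    (hG1 : ∀ (F : FBondY i → 𝔸) (ν : Fin (d + 1)), wNormBY i (-2) (cdB i U ν (GAY i parS parB Gp U F)) ≤ B₀ * wNormBY i (-3) F)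
    (hG3 : ∀ F : FBondY i → 𝔸, wNormBY i (-3) (lapB i U (GAY i parS parB Gp U F)) ≤ B₀ * wNormBY i (-3) F)
    (hcurv : ∀ A : FBondY i → 𝔸, wNormBY i (-3) (coCurlY i U (jordanY i U (curlY i U A) - curlY i U A) + curv2Y i U A) ≤
      κ * wNormBY i (-1) A)
    {A : FBondY i → 𝔸} (hLan : RY i parS Gp U (divY i U A) = 0) :
    wNormBY i (-1) A ≤
        2 * B₀ * (wNormBY i (-3) (coCurlY i U (curlY i U A)) + wNormBY i (-3) (QsY i parB U (aY i (QY i parB U A)))) ∧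
      (∀ ν : Fin (d + 1), wNormBY i (-2) (cdB i U ν A) ≤
        2 * B₀ * (wNormBY i (-3) (coCurlY i U (curlY i U A)) + wNormBY i (-3) (QsY i parB U (aY i (QY i parB U A))))) ∧
      wNormBY i (-3) (lapB i U A) ≤
        2 * B₀ * (wNormBY i (-3) (coCurlY i U (curlY i U A)) + wNormBY i (-3) (QsY i parB U (aY i (QY i parB U A)))) :=
  ⟨wNormBY_neg_one_le i parS parB Gp U hB₀ hθ hU hG0 hcurv hLan,
    fun ν => wNormBY_cdB_le i parS parB Gp U hB₀ hκ hθ hU hG0 hG1 hcurv hLan ν,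
    wNormBY_lapB_le i parS parB Gp U hB₀ hκ hθ hU hG0 hG3 hcurv hLan⟩

/-- **AT THE FLAT BACKGROUND `U = 1` NO CURVATURE BOUND IS NEEDED** (`κ := 0`; B-LINE 1's `curv_apply_one`): the three members from the three (3.47) bounds
of `G(1)` alone — the flat road of r05's `B8Ineq159FlatTorus` ∕ `B8Prop3MultiLevelTorusP26(L0)` at the cell's letters of record.
[cite: Balaban1985RegularSpaces, (1.59) p.86; Balaban1985BackgroundPropagators, (3.26) p.395 («if U = 1»), Cor. 3.5 p.407] -/
theorem ineq159_three_atLettersY_one {parS : SiteParY 𝔸 i} {parB : BondParY 𝔸 i} {Gp : SiteOpY 𝔸 i} (hB₀ : 0 ≤ B₀)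
    (hU : IsUnit (deltaAY i parS parB Gp (fun _ _ => 1)))
    (hG0 : ∀ F : FBondY i → 𝔸, wNormBY i (-1) (GAY i parS parB Gp (fun _ _ => 1) F) ≤ B₀ * wNormBY i (-3) F)
    (hG1 : ∀ (F : FBondY i → 𝔸) (ν : Fin (d + 1)),
      wNormBY i (-2) (cdB i (fun _ _ => 1) ν (GAY i parS parB Gp (fun _ _ => 1) F)) ≤ B₀ * wNormBY i (-3) F)
    (hG3 : ∀ F : FBondY i → 𝔸, wNormBY i (-3) (lapB i (fun _ _ => 1) (GAY i parS parB Gp (fun _ _ => 1) F)) ≤ B₀ * wNormBY i (-3) F)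
    {A : FBondY i → 𝔸} (hLan : RY i parS Gp (fun _ _ => 1) (divY i (fun _ _ => 1) A) = 0) :
    wNormBY i (-1) A ≤
        2 * B₀ * (wNormBY i (-3) (coCurlY i (fun _ _ => 1) (curlY i (fun _ _ => 1) A)) +
          wNormBY i (-3) (QsY i parB (fun _ _ => 1) (aY i (QY i parB (fun _ _ => 1) A)))) ∧
      (∀ ν : Fin (d + 1), wNormBY i (-2) (cdB i (fun _ _ => 1) ν A) ≤
        2 * B₀ * (wNormBY i (-3) (coCurlY i (fun _ _ => 1) (curlY i (fun _ _ => 1) A)) +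
          wNormBY i (-3) (QsY i parB (fun _ _ => 1) (aY i (QY i parB (fun _ _ => 1) A))))) ∧
      wNormBY i (-3) (lapB i (fun _ _ => 1) A) ≤
        2 * B₀ * (wNormBY i (-3) (coCurlY i (fun _ _ => 1) (curlY i (fun _ _ => 1) A)) +
          wNormBY i (-3) (QsY i parB (fun _ _ => 1) (aY i (QY i parB (fun _ _ => 1) A)))) := by
  refine ineq159_three_atLettersY i parS parB Gp (fun _ _ => 1) (κ := 0) hB₀ le_rfl (by simp) hU hG0 hG1 hG3 (fun A' => ?_) hLan
  rw [B8Eq158AtLettersY.curv_apply_one i A', zero_mul]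
  exact wNormBY_le_of_weight_mul_norm_le i le_rfl fun x => by simp

end Ineq159

end Literature.MathematicalPhysics.QuantumFieldTheory.Balaban1983to89.B8Ineq159AtLettersY

end
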